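import Literature.AnabelianGeometry.EtaleTheta.Discharge.Sec2Cor218ProfiniteInnerAutAtModelChi
import Literature.AnabelianGeometry.EtaleTheta.TowerOfSetting
import HarnessLib

/-!
# [EtTh] Cor. 2.18 (i) / Cor. 2.19 (iii) at the stage-2 Tate model `ThetaSetting.modelχq p i j`: an ADMISSIBLE
# automorphism of `Π^tp_X̲̲` that is NEITHER inner NOR «Galois-type» — the intermediate (β1) «every admissible
# `γ` is `Ad(w) ∘ (Galois-type)`» is FALSE AT THE MODEL (proof-only; negative knowledge; row «(β1)-REFUTED-AT-MODEL»)

S. Mochizuki, *The étale theta function and its Frobenioid-theoretic manifestations*, Publ. RIMS **45** (2009)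
[EtTh], Cor. 2.18 (i) p. 60 (clauses (4), (5)), Cor. 2.19 (iii) p. 65 («an arbitrary automorphism of `Π^tp_X̲̲`
preserves this collection of classes … up to some multiple») [cite: MochizukiEtTh2009, Cor 2.19(iii) p.65].

abc-iut cell, layer L6 / K-L6 row «COR219III-M1b», sub-row «(β1)-REFUTED-AT-MODEL» (abc-iut-L6-lead §F v1.19dn,
2026-08-27T03:01:52Z), seat abc-iut-w5-d125 (gen 11), FILE 2 of 2. PROOF-ONLY: no `def`, no instance, no notation,
no new `Prop`-valued fact. Inputs BY NAME: FILE 1 (`exists_conjHatAutχq`, `exists_aPow_conjHat_witness`,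
`conjHat_mem_*_iff`, `ellKer_of_conjHat`, `conjHat_inl_b_ne_conj`), abc-iut-L2-t8's `DoubleUnderline` / `thetaEnvTower`
/ `coe_toLDelta` / `lDeltaTheta_le`, abc-iut-L2-d1's `GtpYdd_modelχq` / `inl_mem_Huuχq_iff` / `mem_dUU_iff`,
abc-iut-C-hgal-2's binder shapes of `cor219_iii_of_hearts` (`Discharge/Sec2Cor219iiiTowerAssembly.lean` l. 82–110).

THE QUESTION. In the K-L6 plan for the even-level heart of [EtTh] Cor. 2.19 (iii) (row «COR219III-M1b») the
intermediate (β1) read: «over `modelχq p i j` (even `j`), for every `X̲̲`-choice `C`, every automorphism `γ` of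
`Π^tp_X̲̲ = C.Huu` admitted by the binders of `cor219_iii_of_hearts` (`γ : Π^tp_X̲̲ ≃ₜ* Π^tp_X̲̲` stabilising `Π^tp_Ÿ̲̲`;
coefficient automorphisms `γ̄_M` compatible with `thetaMod`; clauses (4), (5) of Cor. 2.18 (i)) is `Ad(w) ∘ ν` with
`w ∈ Π^tp_X` and `ν` of Galois type (trivial on the geometric part `Δ_X̲̲ = Π^tp_X̲̲ ∩ Ker aug`)».  abc-iut-w5-d187
(gen 8, HOME/STATUS 2026-08-27T02:58:44Z, finding (N)) observed that profinite-inner automorphisms `Ad(â^u)`,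
`u ∈ Ẑ ∖ ℤ` suitably `l`-adjusted, refute this wording while being harmless for the heart.  THIS FILE is the kernel
form of that observation, for the `X̲̲`-choice of record `Huuχq`.

WHAT IS PROVED (numbers, not adjectives).
* **`exists_admissible_not_inner_modelχq`** — for every prime `p`, all `i`, every even `j`, every `l ≥ 1`, every
  étale-theta datum `E` over `modelχq p i j`, every `X̲̲`-choice `C` with `C.Huu = Huuχq p i j l` (hence `l` odd), every
  cyclotome tower `τ`, `hC`, `hS`: the restriction `γ` to `Π^tp_X̲̲` of FILE 1's `α_h` at its witness `h = a^{s′}`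
  (i) stabilises `Π^tp_Ÿ̲̲` (`T.PiYdd.map γ = T.PiYdd`), (ii) lies over the identity of `G_K`, (iii) satisfies clauses
  (4) and (5) of Cor. 2.18 (i), (iv) is `thetaMod`-compatible with the TRIVIAL coefficient automorphisms `γ̄_M = 1`,
  and (v) for EVERY `w ∈ Π^tp_X` there is `g ∈ Δ_X̲̲` (namely `g = b`) with `γ g ≠ w g w⁻¹`.
* `not_inner_not_galoisType_of_forall` — the three readings of (v): `γ` is not `Ad(w)|_{Π^tp_X̲̲}` for any
  `w ∈ Π^tp_X`; `γ` is not of Galois type (it moves an element of `Δ_X̲̲`); `γ ≠ Ad(w) ∘ ν` for every `w ∈ Π^tp_X` and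
  every self-map `ν` of `Π^tp_X̲̲` fixing `Δ_X̲̲` pointwise.  So (β1) is false at the model for the choice of record.

HONEST LABEL: this refutes the WORDING (β1) at OUR semi-synthetic model of the typed [EtTh] §1 interface only
(refuted-at-a-model ≠ refuted-in-print; the phenomenon is a model artefact — `pr₁ Γ ⊊ F̂₂` has a large normaliser);
it asserts nothing about [EtTh] Cor. 2.18 / 2.19 (refereed), which concern the genuine tempered fundamental group;
it is harmless for the heart (β) of row «COR219III-M1b» (abc-iut-w5-d187's file); no side is taken on [IUTchIII]
Cor. 3.12; typed ≠ proved; nothing here asserts abc proved or refuted.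
-/

noncomputable section

namespace Literature.AnabelianGeometry.EtaleTheta

namespace SettingModel

open Literature.AnabelianGeometry.SemiGraphs _root_.Function _root_.Topology

variable {p : ℕ} [hp : Fact p.Prime] {i j : ℤ}

/-! ## §1. Restriction to a stable subgroup -/

/-- A subgroup stable in both directions under an automorphism is mapped onto itself. [folklore] -/
private theorem map_eq_of_mem_iff {G : Type*} [Group G] (e : G ≃* G) (K : Subgroup G)
    (h : ∀ x, e x ∈ K ↔ x ∈ K) : K.map e.toMonoidHom = K := by
  ext y
  constructor
  · rintro ⟨x, hx, rfl⟩
    exact (h x).mpr hx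
  · intro hy
    exact ⟨e.symm y, (h _).mp (by rw [MulEquiv.apply_symm_apply]; exact hy), e.apply_symm_apply y⟩

/-- **Restricting to a stable subgroup.** A bi-continuous automorphism `α` of `Π^tp_X` with `α(H) = H` (membership
preserved in both directions) restricts to a bi-continuous automorphism of `H`. [folklore] -/
private theorem exists_restrict_continuousMulEquiv_of_mem_iff (α : PiTpχq p i j ≃ₜ* PiTpχq p i j)
    (H : Subgroup (PiTpχq p i j)) (hst : ∀ x, α x ∈ H ↔ x ∈ H) :
    ∃ γ : H ≃ₜ* H, ∀ g : H, ((γ g : H) : PiTpχq p i j) = α g := by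
  have hst' : ∀ x, α.symm x ∈ H ↔ x ∈ H := fun x => by
    rw [← hst (α.symm x), ContinuousMulEquiv.apply_symm_apply]
  let γ₀ : H ≃* H :=
    { toFun := fun g => ⟨α g, (hst _).mpr g.2⟩
      invFun := fun g => ⟨α.symm g, (hst' _).mpr g.2⟩
      left_inv := fun g => Subtype.ext (α.symm_apply_apply (g : PiTpχq p i j))
      right_inv := fun g => Subtype.ext (α.apply_symm_apply (g : PiTpχq p i j))
      map_mul' := fun a b => Subtype.ext (map_mul α _ _) }
  exact ⟨ContinuousMulEquiv.mk γ₀ (Continuous.subtype_mk (α.continuous.comp continuous_subtype_val) _)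
    (Continuous.subtype_mk (α.symm.continuous.comp continuous_subtype_val) _), fun _ => rfl⟩

/-! ## §2. (β1) is false at the model -/

variable (p i j) in
/-- **(β1) is false at the model.**  Over `D := modelχq p i j` (even `j`), for every étale-theta datum `E`, every
`X̲̲`-choice `C` with `C.Huu = Huuχq p i j l` and every cyclotome tower `τ`, there is a bi-continuous automorphism `γ`
of `Π^tp_X̲̲ = (C.thetaEnvTower τ hC hS).PiX` which (i) stabilises `Π^tp_Ÿ̲̲`, (ii) lies over the identity of `G_K`,
(iii) satisfies clauses (4) `γ(Ker(Π^tp_X̲̲ → (Π^tp_X)^Θ)) = Ker` and (5) `γ(θ⁻¹(l·Δ_Θ)) = θ⁻¹(l·Δ_Θ)` of Cor. 2.18 (i),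
(iv) is compatible with `thetaMod` for the TRIVIAL coefficient automorphisms `γ̄_M = 1` — so it is admitted by every
binder of `cor219_iii_of_hearts` — and yet (v) for every `w ∈ Π^tp_X` differs from `Ad(w)` on some element of the
geometric part `Δ_X̲̲ = Π^tp_X̲̲ ∩ Ker aug`: it is neither inner nor `Ad(w) ∘ (Galois-type)`.  The automorphism is the
restriction of conjugation by `inl a^{s′}` in `Π_X` (`s′ ∈ 4l·Ẑ ∖ ℤ`). SEMI-SYNTHETIC MODEL: refutes the wording
(β1) for OUR typed interface only; nothing of [EtTh] is asserted. [cite: MochizukiEtTh2009, Cor 2.19(iii) p.65] -/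
theorem exists_admissible_not_inner_modelχq (hj : Even j) {l : ℕ+}
    {E : (ThetaSetting.modelχq p i j hj).EtaleThetaData} (C : E.DoubleUnderline l)
    (hCH : C.Huu = Huuχq p i j l C.l_odd) {Es : Set ℕ+} (τ : (ThetaSetting.modelχq p i j hj).CyclotomeTower l Es)
    (hC : (ThetaSetting.modelχq p i j hj).Compat) (hS : (ThetaSetting.modelχq p i j hj).Sec2Hyps) :
    ∃ γ : (C.thetaEnvTower τ hC hS).PiX ≃ₜ* (C.thetaEnvTower τ hC hS).PiX,
      (C.thetaEnvTower τ hC hS).PiYdd.map γ.toMulEquiv.toMonoidHom = (C.thetaEnvTower τ hC hS).PiYdd ∧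
      (∀ g, (C.thetaEnvTower τ hC hS).aug (γ g) = (C.thetaEnvTower τ hC hS).aug g) ∧
      ((ThetaSetting.modelχq p i j hj).toTheta.comp C.Huu.subtype).ker.map γ.toMulEquiv.toMonoidHom =
        ((ThetaSetting.modelχq p i j hj).toTheta.comp C.Huu.subtype).ker ∧
      (C.thetaEnvTower τ hC hS).lDeltaTheta.map γ.toMulEquiv.toMonoidHom = (C.thetaEnvTower τ hC hS).lDeltaTheta ∧
      (∃ γμ : ∀ M : Es, (C.thetaEnvTower τ hC hS).mu M ≃* (C.thetaEnvTower τ hC hS).mu M,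
        (∀ M, γμ M = MulEquiv.refl _) ∧
        ∀ (M : Es) (g : (C.thetaEnvTower τ hC hS).lDeltaTheta) (hg : γ g ∈ (C.thetaEnvTower τ hC hS).lDeltaTheta),
          (C.thetaEnvTower τ hC hS).thetaMod M ⟨γ g, hg⟩ = γμ M ((C.thetaEnvTower τ hC hS).thetaMod M g)) ∧
      ∀ w : (ThetaSetting.modelχq p i j hj).PiTemp, ∃ g : (C.thetaEnvTower τ hC hS).PiX,
        (C.thetaEnvTower τ hC hS).aug g = 1 ∧
          ((γ g : C.Huu) : (ThetaSetting.modelχq p i j hj).PiTemp) ≠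
            w * ((g : C.Huu) : (ThetaSetting.modelχq p i j hj).PiTemp) * w⁻¹ := by
  obtain ⟨h, s', hs', hse, hl1, hlσ, h21, h2σ⟩ := exists_aPow_conjHat_witness p i j l C.l_odd
  obtain ⟨α, hα⟩ := exists_conjHatAutχq p i j h
  -- stability of `Π^tp_X̲̲ = Huuχq`, and the restriction `γ`
  have hst : ∀ x : PiTpχq p i j, α x ∈ C.Huu ↔ x ∈ C.Huu := fun x => by
    rw [hCH]; exact conjHat_mem_Huuχq_iff hα C.l_odd hl1 hlσ x
  obtain ⟨γ, hγ⟩ := exists_restrict_continuousMulEquiv_of_mem_iff α C.Huu hst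
  have hT : ∀ g : C.Huu, g ∈ (C.thetaEnvTower τ hC hS).lDeltaTheta →
      ((g : C.Huu) : PiTpχq p i j) ∈ CurveTheta.ellKer (curveχq p i j) := fun g hg => by
    have h1 : (ThetaSetting.modelχq p i j hj).toTheta ((g : C.Huu) : PiTpχq p i j) ∈
        (ThetaSetting.modelχq p i j hj).DeltaTheta :=
      (ThetaSetting.modelχq p i j hj).lDeltaTheta_le l (Subgroup.mem_comap.mp hg)
    exact (CurveTheta.mk_mem_ker_thetaToEll_iff (curveχq p i j) _).mp h1
  refine ⟨γ, ?_, ?_, ?_, ?_, ⟨fun _ => MulEquiv.refl _, fun _ => rfl, ?_⟩, ?_⟩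
  · -- (i) `Π^tp_Ÿ̲̲`-stability: degree, level `2` and the Galois coordinate are preserved
    refine map_eq_of_mem_iff γ.toMulEquiv _ fun g => ?_
    change ((γ g : C.Huu) : PiTpχq p i j) ∈ (ThetaSetting.modelχq p i j hj).GtpYdd ↔
      ((g : C.Huu) : PiTpχq p i j) ∈ (ThetaSetting.modelχq p i j hj).GtpYdd
    rw [hγ, GtpYdd_modelχq p i j hj]
    exact conjHat_mem_YNχq_two_iff hα h21 h2σ _
  · -- (ii) over the identity of `G_K`
    intro g
    apply Subtype.ext
    change augχq p i j ((γ g : C.Huu) : PiTpχq p i j) = augχq p i j ((g : C.Huu) : PiTpχq p i j)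
    rw [hγ, augχq_apply, augχq_apply, right_eq_of_conjHat hα]
  · -- (iii) clause (4): `Ker(Π^tp_X̲̲ → (Π^tp_X)^Θ)` is stable
    refine map_eq_of_mem_iff γ.toMulEquiv _ fun g => ?_
    rw [MonoidHom.mem_ker, MonoidHom.mem_ker]
    change CurveTheta.toTheta (curveχq p i j) ((γ g : C.Huu) : PiTpχq p i j) = 1 ↔
      CurveTheta.toTheta (curveχq p i j) (g : PiTpχq p i j) = 1
    rw [hγ, CurveTheta.toTheta, QuotientGroup.mk'_apply, QuotientGroup.mk'_apply, QuotientGroup.eq_one_iff,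
      QuotientGroup.eq_one_iff]
    exact conjHat_mem_thetaKer_iff hα _
  · -- (iii) clause (5): `θ⁻¹(l·Δ_Θ) ∩ Π^tp_X̲̲ = θ⁻¹(Δ_Θ) ∩ Π^tp_X̲̲` is stable
    refine map_eq_of_mem_iff γ.toMulEquiv _ fun g => ?_
    change γ g ∈ ((ThetaSetting.modelχq p i j hj).lDeltaTheta l).comap
        ((ThetaSetting.modelχq p i j hj).toTheta.comp C.Huu.subtype) ↔
      g ∈ ((ThetaSetting.modelχq p i j hj).lDeltaTheta l).comap ((ThetaSetting.modelχq p i j hj).toTheta.comp C.Huu.subtype)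
    rw [← C.comap_DeltaTheta_Huu, Subgroup.mem_comap, Subgroup.mem_comap]
    change CurveTheta.toTheta (curveχq p i j) ((γ g : C.Huu) : PiTpχq p i j) ∈
        (CurveTheta.thetaToEll (curveχq p i j)).ker ↔
      CurveTheta.toTheta (curveχq p i j) (g : PiTpχq p i j) ∈ (CurveTheta.thetaToEll (curveχq p i j)).ker
    rw [hγ, CurveTheta.mk_mem_ker_thetaToEll_iff, CurveTheta.mk_mem_ker_thetaToEll_iff]
    exact conjHat_mem_ellKer_iff hα _
  · -- (iv) `thetaMod`-compatibility with `γ̄_M = 1`: `θ(γ g) = θ(g)` on `θ⁻¹(Δ_Θ) ∩ Π^tp_X̲̲`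
    intro M g hg
    rw [MulEquiv.refl_apply]
    change (τ.mod M).red (C.toLDelta ⟨γ g, hg⟩) = (τ.mod M).red (C.toLDelta g)
    congr 1
    apply Subtype.ext
    rw [ThetaSetting.EtaleThetaData.DoubleUnderline.coe_toLDelta, ThetaSetting.EtaleThetaData.DoubleUnderline.coe_toLDelta]
    change CurveTheta.toTheta (curveχq p i j) ((γ g : C.Huu) : PiTpχq p i j) =
      CurveTheta.toTheta (curveχq p i j) ((g : C.Huu) : PiTpχq p i j)
    rw [hγ]
    exact (ellKer_of_conjHat hα (hT _ g.2)).2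
  · -- (v) not inner on `Δ_X̲̲`: the test element `b`
    intro w
    have hb : (SemidirectProduct.inl (gfpOf (FreeGroup.of 1)) : PiTpχq p i j) ∈ C.Huu := by
      rw [hCH, inl_mem_Huuχq_iff, mem_dUU_iff]
      change (hHat l (eta (FreeGroup.of 1))).x = 0 ∧ (hHat l (eta (FreeGroup.of 1))).z = 0
      rw [hHat_eta, heisHom_of_one, Heis.map_apply]
      exact ⟨map_zero _, map_zero _⟩
    refine ⟨⟨_, hb⟩, Subtype.ext ?_, fun heq => conjHat_inl_b_ne_conj hα hse hs' w ?_⟩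
    · change augχq p i j (SemidirectProduct.inl (gfpOf (FreeGroup.of 1))) = 1
      rw [augχq_apply, SemidirectProduct.right_inl]
    · exact (hγ ⟨_, hb⟩).symm.trans heq

/-- **The three readings of «not `Ad(w) ∘ (Galois-type)`»**, from clause (v) of `exists_admissible_not_inner_modelχq`:
an automorphism `γ` of `Π^tp_X̲̲` that differs from every `Ad(w)` somewhere on `Δ_X̲̲ = Π^tp_X̲̲ ∩ Ker aug` is (a) not
the restriction of an inner automorphism `Ad(w)`, `w ∈ Π^tp_X`; (b) not of Galois type (it moves some element of
`Δ_X̲̲`); (c) not `Ad(w) ∘ ν` for any `w ∈ Π^tp_X` and any self-map `ν` of `Π^tp_X̲̲` fixing `Δ_X̲̲` pointwise.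
[cite: MochizukiEtTh2009, Cor 2.19(iii) p.65] -/
theorem not_inner_not_galoisType_of_forall {P : Type*} [Group P] {H : Subgroup P} {A : Type*} [One A]
    (aug : H → A) (γ : H → H)
    (hγ : ∀ w : P, ∃ g : H, aug g = 1 ∧ ((γ g : H) : P) ≠ w * (g : P) * w⁻¹) :
    (¬ ∃ w : P, ∀ g : H, ((γ g : H) : P) = w * (g : P) * w⁻¹) ∧
      (∃ g : H, aug g = 1 ∧ γ g ≠ g) ∧
      ¬ ∃ (w : P) (ν : H → H), (∀ g, aug g = 1 → ν g = g) ∧ ∀ g, ((γ g : H) : P) = w * (ν g : P) * w⁻¹ := by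
  refine ⟨?_, ?_, ?_⟩
  · rintro ⟨w, hw⟩
    obtain ⟨g, -, hg⟩ := hγ w
    exact hg (hw g)
  · obtain ⟨g, hg1, hg⟩ := hγ 1
    refine ⟨g, hg1, fun h => hg ?_⟩
    rw [h, one_mul, inv_one, mul_one]
  · rintro ⟨w, ν, hν, hw⟩
    obtain ⟨g, hg1, hg⟩ := hγ w
    exact hg (by rw [hw g, hν g hg1])

end SettingModel

end Literature.AnabelianGeometry.EtaleTheta

end
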